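import Literature.NumberTheory.EllipticCurves.Kato2004.AdmissibleZetaClassPositionProofs
import Literature.NumberTheory.GaloisRepresentations.ContinuousCorestrictionResNormal
import HarnessLib

/-!
# Kato 2004 (Astérisque 295): LAYER-VANISHING ⇒ VALUE-VANISHING for a `ZetaBody` family — if the layer-`n`
# corestriction `Cor_{ℚ(μ_{p^{n+1}})/ℚ_n}(z_{n+1,∅})` of Kato's zeta family vanishes, then every character sum
# `Σ_b χ(b)·ι(σ_b x_{n+1,∅})` over a Dirichlet character `χ mod p^{n+1}` of `Gal(ℚ_n/ℚ)` vanishes, hence (value law)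
# `L_{S}(f, χ, 1) · R^∓_χ̄(c, d, a, A, d′) = 0`; in particular for an ADMISSIBLE zeta class `z₀ = 0` (THEOREMS ONLY)

Topic `NumberTheory/EllipticCurves`, sub-directory `Kato2004` (namespace = path). THEOREMS ONLY (net debt 0): no
`def … : Prop`, no named fact, no instance, no notation, no `sorry`. Seat `bsd-cm-prr-ty1` (literature-prover, cell
`bsd-cm`; K-CUT-2 input (a) of planner D384/D388 for stub 4 `stub_realizableOfKMCFine` of the Kato–Perrin-Riou skeletons
on cruxes stmt-BirchSwinnertonDyer-19945 / -19223). HONEST FRAMING: BSD is not proved by any of this; nothing about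
Kato's Main Conjecture or Perrin-Riou's conjecture is asserted; every statement is CONDITIONAL on a `ZetaBody` witness
(resp. an admissible class) given as a hypothesis.

## What (the all-layers twin of `EulerSystemClassNonvanishingProofs.zetaBody_bottom_ne_zero`)

`EulerSystemClassNonvanishingProofs` proved the BOTTOM-layer value side: `z_{0,∅} ≠ 0` when `L(W,1) ≠ 0` (the trivial
character of level `1`). On rows of analytic rank `≥ 1` the bottom value vanishes and one must read the Λ-adic lift
`𝐲` (`I.proj n 𝐲 = Cor_{ℚ(μ_{p^{n+1}})/ℚ_n}(z_{n+1,∅})`, `levelToLayer`) at a HIGHER layer through a non-trivial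
character of `Gal(ℚ_n/ℚ)`. This file proves the mechanism, for every `n`:

* §1 (character sums, pure algebra in `ℚ(ζ_m)`): `charSum χ` is additive, `σ_h`-invariant for `χ(h) = 1`
  (`charSum_sigma_of_apply_eq_one`), hence kills every `x` with `Σ_i σ_{h_i} x = 0` over a non-empty family of `h_i`
  with `χ(h_i) = 1` (`charSum_eq_zero_of_sum_sigma_eq_zero`).
* §2 (cohomology, any topological representation): `cor ξ = 0 ⇒ Σ_{reps} conj ξ = 0` — the normal case of the double
  coset formula `res ∘ cor = Σ conj` (`resLe_coresLe_eq_sum_conjMap`).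
* §3 (the `ZetaBody` family): if `levelToLayer … n (z (n+1) ∅) = 0` then, applying the value functional `Λ_{n+1,∅}`
  (Galois-equivariant, (C3a); value `1 ⊗ x_{n+1,∅}`, (C4)) and the injectivity of `y ↦ 1 ⊗ y`,
  `Σ_{reps δ of Gal(ℚ̄/ℚ_n)/Gal(ℚ̄/ℚ(μ_{p^{n+1}}))} σ_{χ_cyc(δ)} x_{n+1,∅} = 0`; so by §1 `charSum χ x_{n+1,∅} = 0` for
  every Dirichlet `χ mod p^{n+1}` with `χ(χ_cyc(σ)) = 1` for all `σ ∈ Gal(ℚ̄/ℚ_n)` (the characters of `Gal(ℚ_n/ℚ)`;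
  `charSum_eq_zero_of_levelToLayer_eq_zero`), and by the value law (C5) `κ·L_S(f,χ,1)/Ω⁺_f·R⁻_χ̄ = 0` for even such
  `χ` (`… /(iΩ⁻_f)·R⁺_χ̄` for odd), i.e. `L_S(f,χ,1)·R^∓_χ̄ = 0` when `κ ≠ 0` and `f` is the newform of `W`
  (`Ω^±_f > 0`).
* §4 (admissible classes, `Kato2004/AdmissibleZetaClass.lean`): if `z₀ ∈ 𝐇¹_Γ(T_pW)` is admissible and `z₀ = 0`,
  then the Λ-adic lift `y` of ITS Kato family vanishes (`IwasawaH1Data.eq_zero_iff_of_smul_eq_smul`, p619785), so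
  by §3 EVERY such depleted twisted value of that family satisfies `L_S(f,χ,1)·R⁻_χ̄(c,d₁,a,A,d′) = 0`, at every layer,
  for the guarded parameters `(c, d₁, a, A, d′)` of the witness (`R⁻_𝟙 ≠ 0`)
  (`AdmissibleZetaClassBody.exists_forall_value_eq_zero_of_eq_zero`, closed form `IsAdmissibleZetaClass.…`).
  CONTRAPOSITIVE (the consumer's road to `z₀ ≠ 0`, NOT taken here): one character `χ` of `Gal(ℚ_n/ℚ)` of conductor
  `p^{n+1}` with `L(f,χ,1) ≠ 0` (Rohrlich; tree: `Rohrlich1984_nonvanishing_twists_holds` for `p ∤ N`,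
  `Summit…PSRohrlichAtLevel.rohrlich_primePow_of_isNewformOf` for any `p`), non-vanishing Euler factors at the
  depleted primes, and `R⁻_χ̄ ≠ 0` gives `z₀ ≠ 0`.

## Source

K. Kato, Astérisque 295 (2004) [Kato2004Asterisque]: §13.8 [p. 228] (the trace to the `Δ`-trivial component /
layers), Thm. 12.5 (1) [pp. 221–222] ("`x ⊗ y ↦ Σ_{σ∈G_n} χ(σ)σ(y) per_f(x)^±` … sends the image of `𝐳_γ^{(p)}` to
`(2πi)^{k−r−1}·L_{{p}}(f*,χ,r)·γ^±`" — the Λ-adic element is read through character sums at the finite layers),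
Thm. 9.7 [p. 189] and Thm. 6.6 (1) [p. 163] (the value law (C5) of `ZetaBody`), Ex. 13.3 [p. 225]; J. Neukirch,
A. Schmidt, K. Wingberg, *Cohomology of Number Fields* (2008) I §5 (1.5.6)–(1.5.7) (`res ∘ cor`) [NeukirchSchmidtWingberg2008];
L. C. Washington, *Introduction to Cyclotomic Fields* §13.1 (`ℚ_n ⊂ ℚ(ζ_{p^{n+1}})`) [Washington1997]. Nothing beyond
these readings (all already of record in `EulerSystemValues.lean`, `IwasawaH1LayerNormProofs.lean`,
`IwasawaCohomologyZetaLift.lean`) is used.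
-/

set_option autoImplicit false

noncomputable section

open scoped BigOperators NumberField TensorProduct
open Field IsDedekindDomain CongruenceSubgroup
open Literature.NumberTheory.GaloisRepresentations
open Literature.NumberTheory.EllipticCurves Literature.NumberTheory.EllipticCurves.ModularForms
open Literature.NumberTheory.EllipticCurves.Kato2004.EulerSystemValues Rat.HeightOneSpectrum

namespace Literature.NumberTheory.EllipticCurves.Kato2004

/-! ## §1 Character sums: additivity, `σ_h`-invariance for `χ(h) = 1`, vanishing on norm-zero elements -/

namespace EulerSystemValues

variable {m : ℕ} [NeZero m] (ι : CyclotomicField m ℚ →+* ℂ) (χ : DirichletCharacter ℂ m)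

set_option backward.isDefEq.respectTransparency false in
/-- `σ_{bh} = σ_b ∘ σ_h` (Kato (5.7.1): `b ↦ σ_b` is a homomorphism `(ℤ/m)ˣ → Gal(ℚ(ζ_m)/ℚ)`). (Restates the
Summits-side tool lemma `Summit.BirchSwinnertonDyer.Rank1Residual.GaloisImage.CharSum.sigma_mul_apply` of
`KatoCharSumFourierInversion.lean`, which a Literature file cannot import.) [cite: Kato2004Asterisque, (5.7.1) (p. 157)] -/
theorem sigma_mul_apply (b h : (ZMod m)ˣ) (x : CyclotomicField m ℚ) :
    sigma m (b * h) x = sigma m b (sigma m h x) := by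
  unfold sigma
  rw [map_mul, AlgEquiv.mul_apply]

/-- `charSum` is additive in `x`. [folklore] -/
private theorem charSum_add (x y : CyclotomicField m ℚ) :
    charSum m ι χ (x + y) = charSum m ι χ x + charSum m ι χ y := by
  simp only [charSum, map_add, mul_add, Finset.sum_add_distrib]

/-- `charSum χ 0 = 0`. [folklore] -/
private theorem charSum_zero : charSum m ι χ 0 = 0 := by
  simp only [charSum, map_zero, mul_zero, Finset.sum_const_zero]

/-- `charSum` of a finite sum. [folklore] -/
private theorem charSum_sum {α : Type*} (s : Finset α) (g : α → CyclotomicField m ℚ) :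
    charSum m ι χ (∑ i ∈ s, g i) = ∑ i ∈ s, charSum m ι χ (g i) :=
  map_sum (AddMonoidHom.mk' (charSum m ι χ) (charSum_add ι χ)) g s

/-- **`σ_h`-invariance**: `Σ_b χ(b) ι(σ_b σ_h x) = Σ_b χ(b) ι(σ_b x)` when `χ(h) = 1` (re-index `b ↦ bh`; in general the
sum acquires the factor `χ̄(h)` — Kato Thm. 6.6 (1): the `χ`-component). [cite: Kato2004Asterisque, Thm. 6.6 (1) (p. 163)] -/
theorem charSum_sigma_of_apply_eq_one {h : (ZMod m)ˣ} (hh : χ (h : ZMod m) = 1) (x : CyclotomicField m ℚ) :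
    charSum m ι χ (sigma m h x) = charSum m ι χ x := by
  unfold charSum
  calc ∑ b : (ZMod m)ˣ, χ (b : ZMod m) * ι (sigma m b (sigma m h x))
      = ∑ b : (ZMod m)ˣ, χ ((b * h : (ZMod m)ˣ) : ZMod m) * ι (sigma m (b * h) x) := by
        refine Finset.sum_congr rfl fun b _ => ?_
        rw [sigma_mul_apply, Units.val_mul, map_mul, hh, mul_one]
    _ = ∑ b : (ZMod m)ˣ, χ (b : ZMod m) * ι (sigma m b x) :=
        Fintype.sum_equiv (Equiv.mulRight h) _ _ (fun _ => rfl)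

/-- **Character sums kill norm-zero elements**: if `Σ_{i ∈ s} σ_{h_i} x = 0` for a NON-EMPTY finite family `(h_i)`
with `χ(h_i) = 1`, then `Σ_b χ(b) ι(σ_b x) = 0` (apply `charSum`, which is additive and `σ_{h_i}`-invariant:
`#s · charSum χ x = 0`). For `(h_i)` = the image of `Gal(ℚ(μ_{p^{n+1}})/ℚ_n)` this is the passage from the layer
`ℚ_n` to the `χ`-components, `χ` a character of `Gal(ℚ_n/ℚ)` (Kato §13.8). [cite: Kato2004Asterisque, §13.8 (p. 228)] -/
theorem charSum_eq_zero_of_sum_sigma_eq_zero {α : Type*} {s : Finset α} (hs : s.Nonempty)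
    {b : α → (ZMod m)ˣ} (hb : ∀ i ∈ s, χ (b i : ZMod m) = 1) {x : CyclotomicField m ℚ}
    (h0 : ∑ i ∈ s, sigma m (b i) x = 0) : charSum m ι χ x = 0 := by
  have key : charSum m ι χ (∑ i ∈ s, sigma m (b i) x) = (s.card : ℂ) * charSum m ι χ x := by
    rw [charSum_sum, Finset.sum_congr rfl fun i hi => charSum_sigma_of_apply_eq_one ι χ (hb i hi) x,
      Finset.sum_const, nsmul_eq_mul]
  rw [h0, charSum_zero] at key
  have hcard : (s.card : ℂ) ≠ 0 := Nat.cast_ne_zero.mpr hs.card_pos.ne'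
  exact (mul_eq_zero.mp key.symm).resolve_left hcard

end EulerSystemValues

/-! ## §2 Cohomology: `cor ξ = 0 ⇒ Σ_{reps} conj ξ = 0` -/

section Cohomology

universe u v

variable {R : Type u} [Ring R] [TopologicalSpace R] {G : Type v} [Group G] [TopologicalSpace G]
  [IsTopologicalGroup G] (X : TopRep.{v} R G)

/-- **If the corestriction of `ξ ∈ H¹(N, X)` to `U ≥ N` vanishes, so does its norm `Σ_{x ∈ U/N} s(x)·ξ`** (`N` normal
and open, `s` any system of representatives): `Σ s(x)·ξ = res (cor ξ) = res 0 = 0`.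
[cite: NeukirchSchmidtWingberg2008, I §5 (1.5.6)–(1.5.7)] -/
theorem sum_conjMap_eq_zero_of_coresLe_eq_zero {N U : Subgroup G} [N.Normal] (h : N ≤ U)
    (hN : IsOpen (N : Set G)) [Fintype (U ⧸ N.subgroupOf U)] {s : U ⧸ N.subgroupOf U → U}
    (hs : ∀ x, (s x : U ⧸ N.subgroupOf U) = x) {ξ : continuousCohomology 1 (subgroupRep X N)}
    (h0 : coresLe X h hN ξ = 0) : ∑ x, conjMap X N (s x : G) 1 ξ = 0 := by
  rw [← resLe_coresLe_eq_sum_conjMap X h hN hs ξ, h0]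
  exact map_zero _

end Cohomology

/-! ## §3 The `ZetaBody` family: layer-vanishing ⇒ character sums and values vanish -/

section Core

variable {W : WeierstrassCurve ℚ} [W.IsElliptic] {p : ℕ} [Fact p.Prime]
  [ContinuousSMul ℤ_[p] (W.tateModule p)]

/-- **The mechanism, abstractly.** Let `Λ₀ : H¹(ℚ(μ_m), T_pW) → ℚ_p ⊗ ℚ(ζ_m)` (`m = m(k,r)`) be `ℤ_p`-linear and
`Gal(ℚ(μ_m)/ℚ)`-equivariant (the shape of (C3a)), `ξ` a class with `Λ₀(ξ) = 1 ⊗ x₁` ((C4) shape), and `U ≥ Gal(ℚ̄/ℚ(μ_m))`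
a subgroup to which `ξ` corestricts to ZERO. Then `Σ_{y ∈ U/Gal(ℚ̄/ℚ(μ_m))} σ_{χ_cyc(s(y))} x₁ = 0` in `ℚ(ζ_m)` for the
representatives `s = Quotient.out`: `res (cor ξ) = Σ conj_{s(y)} ξ` (§2), apply `Λ₀`, and `y ↦ 1 ⊗ y` is injective
(`ℚ(ζ_m)` is flat over `ℚ`). [cite: Kato2004Asterisque, §13.8 (p. 228)] [cite: NeukirchSchmidtWingberg2008, I §5 (1.5.6)–(1.5.7)] -/
theorem sum_sigma_eq_zero_of_coresLe_eq_zero {U : Subgroup (absoluteGaloisGroup ℚ)} (k : ℕ)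
    (r : Finset (HeightOneSpectrum (𝓞 ℚ))) (hle : cycSubgroup p k r ≤ U)
    [Fintype (U ⧸ (cycSubgroup p k r).subgroupOf U)]
    (Λ₀ : H1 (tateRep W p) (cycSubgroup p k r) →ₗ[ℤ_[p]] ℚ_[p] ⊗[ℚ] CyclotomicField (cycLevel p k r) ℚ)
    (hΛ : ∀ (σ : absoluteGaloisGroup ℚ) (y : H1 (tateRep W p) (cycSubgroup p k r)),
      Λ₀ (conjMap (tateRep W p).toTopRep (cycSubgroup p k r) σ 1 y) =
        Algebra.TensorProduct.map (AlgHom.id ℚ ℚ_[p])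
          (sigma (cycLevel p k r) (modNCyclotomicCharacter ℚ (cycLevel p k r) σ) :
            CyclotomicField (cycLevel p k r) ℚ →ₐ[ℚ] CyclotomicField (cycLevel p k r) ℚ) (Λ₀ y))
    {ξ : H1 (tateRep W p) (cycSubgroup p k r)} {x₁ : CyclotomicField (cycLevel p k r) ℚ}
    (hξ : Λ₀ ξ = (1 : ℚ_[p]) ⊗ₜ[ℚ] x₁)
    (h0 : coresLe (tateRep W p).toTopRep hle ((cyclotomicLevelsRat p ∅).isOpen_level k r) ξ = 0) :
    ∑ y : U ⧸ (cycSubgroup p k r).subgroupOf U,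
      sigma (cycLevel p k r)
        (modNCyclotomicCharacter ℚ (cycLevel p k r) ((Quotient.out y : U) : absoluteGaloisGroup ℚ)) x₁ = 0 := by
  have hs : ∀ y : U ⧸ (cycSubgroup p k r).subgroupOf U,
      ((Quotient.out y : U) : U ⧸ (cycSubgroup p k r).subgroupOf U) = y :=
    fun y => QuotientGroup.out_eq' y
  -- §2: the norm of `ξ` along `U / Gal(ℚ̄/ℚ(μ_m))` vanishes
  have h1 := sum_conjMap_eq_zero_of_coresLe_eq_zero (tateRep W p).toTopRep hle
    ((cyclotomicLevelsRat p ∅).isOpen_level k r) hs h0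
  -- apply `Λ₀`
  have h2 : ∑ y : U ⧸ (cycSubgroup p k r).subgroupOf U,
      Λ₀ (conjMap (tateRep W p).toTopRep (cycSubgroup p k r)
        ((Quotient.out y : U) : absoluteGaloisGroup ℚ) 1 ξ) = 0 := by
    rw [← map_sum, h1, map_zero]
  have h3 : ∑ y : U ⧸ (cycSubgroup p k r).subgroupOf U,
      (1 : ℚ_[p]) ⊗ₜ[ℚ] sigma (cycLevel p k r)
        (modNCyclotomicCharacter ℚ (cycLevel p k r) ((Quotient.out y : U) : absoluteGaloisGroup ℚ)) x₁ = 0 := by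
    rw [← h2]
    refine Finset.sum_congr rfl fun y _ => ?_
    rw [hΛ, hξ, Algebra.TensorProduct.map_tmul]
    rfl
  rw [← TensorProduct.tmul_sum] at h3
  -- `y ↦ 1 ⊗ y` is injective
  haveI : Module.Free ℚ (CyclotomicField (cycLevel p k r) ℚ) := Module.Free.of_divisionRing ℚ _
  have hinj := Algebra.TensorProduct.includeRight_injective (R := ℚ) (A := ℚ_[p])
    (B := CyclotomicField (cycLevel p k r) ℚ) (algebraMap ℚ ℚ_[p]).injective
  apply hinj
  change (1 : ℚ_[p]) ⊗ₜ[ℚ] _ = (1 : ℚ_[p]) ⊗ₜ[ℚ] (0 : CyclotomicField _ ℚ)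
  rw [h3, TensorProduct.tmul_zero]

/-- **The mechanism, for character sums.** Under the hypotheses of `sum_sigma_eq_zero_of_coresLe_eq_zero`, every
Dirichlet character `χ mod m` killing `χ_cyc(U)` has `Σ_b χ(b) ι(σ_b x₁) = 0` (§1).
[cite: Kato2004Asterisque, §13.8 (p. 228), Thm. 12.5 (1) (pp. 221–222)] -/
theorem charSum_eq_zero_of_coresLe_eq_zero {U : Subgroup (absoluteGaloisGroup ℚ)} (k : ℕ)
    (r : Finset (HeightOneSpectrum (𝓞 ℚ))) (hle : cycSubgroup p k r ≤ U)
    [Fintype (U ⧸ (cycSubgroup p k r).subgroupOf U)]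
    (Λ₀ : H1 (tateRep W p) (cycSubgroup p k r) →ₗ[ℤ_[p]] ℚ_[p] ⊗[ℚ] CyclotomicField (cycLevel p k r) ℚ)
    (hΛ : ∀ (σ : absoluteGaloisGroup ℚ) (y : H1 (tateRep W p) (cycSubgroup p k r)),
      Λ₀ (conjMap (tateRep W p).toTopRep (cycSubgroup p k r) σ 1 y) =
        Algebra.TensorProduct.map (AlgHom.id ℚ ℚ_[p])
          (sigma (cycLevel p k r) (modNCyclotomicCharacter ℚ (cycLevel p k r) σ) :
            CyclotomicField (cycLevel p k r) ℚ →ₐ[ℚ] CyclotomicField (cycLevel p k r) ℚ) (Λ₀ y))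
    {ξ : H1 (tateRep W p) (cycSubgroup p k r)} {x₁ : CyclotomicField (cycLevel p k r) ℚ}
    (hξ : Λ₀ ξ = (1 : ℚ_[p]) ⊗ₜ[ℚ] x₁)
    (h0 : coresLe (tateRep W p).toTopRep hle ((cyclotomicLevelsRat p ∅).isOpen_level k r) ξ = 0)
    (ι₀ : CyclotomicField (cycLevel p k r) ℚ →+* ℂ) (χ : DirichletCharacter ℂ (cycLevel p k r))
    (hχ : ∀ σ ∈ U, χ ((modNCyclotomicCharacter ℚ (cycLevel p k r) σ : (ZMod (cycLevel p k r))ˣ) :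
      ZMod (cycLevel p k r)) = 1) :
    charSum (cycLevel p k r) ι₀ χ x₁ = 0 :=
  charSum_eq_zero_of_sum_sigma_eq_zero ι₀ χ Finset.univ_nonempty (fun y _ => hχ _ (Quotient.out y).2)
    (sum_sigma_eq_zero_of_coresLe_eq_zero k r hle Λ₀ hΛ hξ h0)

end Core

section LayerValues

variable {W : WeierstrassCurve ℚ} [W.IsElliptic] {p : ℕ} [Fact p.Prime]
  [ContinuousSMul ℤ_[p] (W.tateModule p)] [Module.Free ℤ_[p] (W.tateModule p)]
  [Module.Finite ℤ_[p] (W.tateModule p)] {N : ℕ} {f : CuspForm (Gamma0 N) 2}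
  {ι : (m : ℕ) → (CyclotomicField m ℚ →+* ℂ)} {κ' : ℝ}
  {Λ' : ∀ (k : ℕ) (r : Finset (HeightOneSpectrum (𝓞 ℚ))),
    H1 (tateRep W p) (cycSubgroup p k r) →ₗ[ℤ_[p]] ℚ_[p] ⊗[ℚ] CyclotomicField (cycLevel p k r) ℚ}
  {c d a : ℤ} {A : ℕ}
  {z : ∀ (k : ℕ) (r : (cyclotomicLevelsRat p (badPlaces c d A N)).Ideals),
    H1 (tateRep W p) ((cyclotomicLevelsRat p (badPlaces c d A N)).level k r.1)}
  {x : ∀ (k : ℕ) (r : (cyclotomicLevelsRat p (badPlaces c d A N)).Ideals),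
    CyclotomicField (cycLevel p k r.1) ℚ}
  {K : ZpExtension ℚ p}

/-- **Layer-vanishing ⇒ the character sums of `x_{n+1,∅}` vanish on the characters of `Gal(ℚ_n/ℚ)`.** Let
`(Λ, κ, z, x)` satisfy `ZetaBody` and suppose `Cor_{ℚ(μ_{p^{n+1}})/ℚ_n}(z_{n+1,∅}) = 0` (`levelToLayer`, `p` odd,
`K` a cyclotomic `ℤ_p`-extension). Then `res ∘ cor = Σ_{δ} conj_δ` over representatives `δ` of
`Gal(ℚ̄/ℚ_n)/Gal(ℚ̄/ℚ(μ_{p^{n+1}}))` (§2), the value functional `Λ_{n+1,∅}` is Galois-equivariant (C3a) with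
`Λ(z_{n+1,∅}) = 1 ⊗ x_{n+1,∅}` (C4), and `y ↦ 1 ⊗ y` is injective, so `Σ_δ σ_{χ_cyc(δ)} x_{n+1,∅} = 0` in
`ℚ(ζ_{p^{n+1}})`; by §1, `Σ_b χ(b) ι(σ_b x_{n+1,∅}) = 0` for every Dirichlet character `χ mod p^{n+1}` trivial on
`χ_cyc(Gal(ℚ̄/ℚ_n))`, i.e. every character of `Gal(ℚ_n/ℚ)`.
[cite: Kato2004Asterisque, §13.8 (p. 228), Thm. 12.5 (1) (pp. 221–222)] [cite: NeukirchSchmidtWingberg2008, I §5 (1.5.6)–(1.5.7)] -/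
theorem charSum_eq_zero_of_levelToLayer_eq_zero (hbody : ZetaBody W p f ι κ' Λ' c d a A z x)
    (hK : K.IsCyclotomic) (hp : p ≠ 2) (n : ℕ)
    (h0 : levelToLayer W p hK hp (badPlaces c d A N) n
      (z (n + 1) (cyclotomicLevelsRat p (badPlaces c d A N)).idealOne) = 0)
    (χ : DirichletCharacter ℂ (cycLevel p (n + 1) ∅))
    (hχ : ∀ σ ∈ K.layerSubgroup n,
      χ ((modNCyclotomicCharacter ℚ (cycLevel p (n + 1) ∅) σ : (ZMod (cycLevel p (n + 1) ∅))ˣ) :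
        ZMod (cycLevel p (n + 1) ∅)) = 1) :
    charSum (cycLevel p (n + 1) ∅) (ι (cycLevel p (n + 1) ∅)) χ
      (x (n + 1) (cyclotomicLevelsRat p (badPlaces c d A N)).idealOne) = 0 := by
  -- the level subgroup `Gal(ℚ̄/ℚ(μ_{p^{n+1}}))`, written on `S = ∅` (`cycSubgroup_eq_level`: it IS the level of `z`)
  have hle : cycSubgroup p (n + 1) ∅ ≤ K.layerSubgroup n :=
    hK.cyclotomicLevelsRat_level_succ_le_layerSubgroup hp (badPlaces c d A N) n
  letI : Fintype (K.layerSubgroup n ⧸ (cycSubgroup p (n + 1) ∅).subgroupOf (K.layerSubgroup n)) :=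
    Fintype.ofFinite _
  obtain ⟨-, -, hC3a, -, hC4, -⟩ := hbody
  have hξ : Λ' (n + 1) ∅ (z (n + 1) (cyclotomicLevelsRat p (badPlaces c d A N)).idealOne) =
      (1 : ℚ_[p]) ⊗ₜ[ℚ] (x (n + 1) (cyclotomicLevelsRat p (badPlaces c d A N)).idealOne :
        CyclotomicField (cycLevel p (n + 1) ∅) ℚ) :=
    hC4 (n + 1) (cyclotomicLevelsRat p (badPlaces c d A N)).idealOne
  have h0' : coresLe (tateRep W p).toTopRep hle ((cyclotomicLevelsRat p ∅).isOpen_level (n + 1) ∅)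
      (z (n + 1) (cyclotomicLevelsRat p (badPlaces c d A N)).idealOne :
        H1 (tateRep W p) (cycSubgroup p (n + 1) ∅)) = 0 := by
    unfold levelToLayer at h0
    exact h0
  exact charSum_eq_zero_of_coresLe_eq_zero (n + 1) ∅ hle (Λ' (n + 1) ∅) (hC3a (n + 1) ∅) hξ h0'
    (ι (cycLevel p (n + 1) ∅)) χ hχ

/-- **Layer-vanishing ⇒ the EVEN depleted twisted values against the minus cusp factor vanish** (value law (C5)):
under the hypotheses of `charSum_eq_zero_of_levelToLayer_eq_zero`, for every even such `χ`, every `d′` with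
`dd′ ≡ 1 (A)`, `(cd, p^{n+1}A) = 1`, and every entire continuation `Lχ` of `Σ_{(k,pA·p^{n+1})=1} a_kχ(k)k^{-s}`:
`κ · Lχ(1)/Ω⁺_f · R⁻_χ̄(c,d,a,A,d′) = 0`. [cite: Kato2004Asterisque, Thm. 9.7 (p. 189), Thm. 6.6 (1) (p. 163), §13.8 (p. 228)] -/
theorem zetaBody_value_even_eq_zero_of_levelToLayer_eq_zero (hbody : ZetaBody W p f ι κ' Λ' c d a A z x)
    (hK : K.IsCyclotomic) (hp : p ≠ 2) (n : ℕ)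
    (h0 : levelToLayer W p hK hp (badPlaces c d A N) n
      (z (n + 1) (cyclotomicLevelsRat p (badPlaces c d A N)).idealOne) = 0)
    (χ : DirichletCharacter ℂ (cycLevel p (n + 1) ∅))
    (hχ : ∀ σ ∈ K.layerSubgroup n,
      χ ((modNCyclotomicCharacter ℚ (cycLevel p (n + 1) ∅) σ : (ZMod (cycLevel p (n + 1) ∅))ˣ) :
        ZMod (cycLevel p (n + 1) ∅)) = 1)
    (heven : χ (-1) = 1) (d' : ℤ) (hcd : Int.gcd (c * d) (cycLevel p (n + 1) ∅ * A) = 1)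
    (hdd' : d * d' ≡ 1 [ZMOD (A : ℤ)]) {Lχ : ℂ → ℂ}
    (hLχ : IsDepletedTwistedL f (cycLevel p (n + 1) ∅) (p * A) χ Lχ) :
    (κ' : ℂ) * (Lχ 1 / (plusPeriod f : ℂ)) *
      cuspFactor f true (fun k ↦ χ⁻¹ (k : ZMod (cycLevel p (n + 1) ∅))) c d a A d' = 0 := by
  have h5 := ((hbody.2.2.2.2.2) (n + 1) (cyclotomicLevelsRat p (badPlaces c d A N)).idealOne d' χ Lχ hcd
    hdd' hLχ).1 heven
  have hcs : charSum (cycLevel p (n + 1) (cyclotomicLevelsRat p (badPlaces c d A N)).idealOne.1)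
      (ι (cycLevel p (n + 1) (cyclotomicLevelsRat p (badPlaces c d A N)).idealOne.1)) χ
      (x (n + 1) (cyclotomicLevelsRat p (badPlaces c d A N)).idealOne) = 0 :=
    charSum_eq_zero_of_levelToLayer_eq_zero hbody hK hp n h0 χ hχ
  rw [hcs] at h5
  exact h5.symm

/-- The ODD twin (for the record; a character of `Gal(ℚ_n/ℚ)` is even, so this clause is not used downstream):
`κ · Lχ(1)/(iΩ⁻_f) · R⁺_χ̄ = 0` for odd such `χ`. [cite: Kato2004Asterisque, Thm. 9.7 (p. 189), Thm. 6.6 (1) (p. 163)] -/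
theorem zetaBody_value_odd_eq_zero_of_levelToLayer_eq_zero (hbody : ZetaBody W p f ι κ' Λ' c d a A z x)
    (hK : K.IsCyclotomic) (hp : p ≠ 2) (n : ℕ)
    (h0 : levelToLayer W p hK hp (badPlaces c d A N) n
      (z (n + 1) (cyclotomicLevelsRat p (badPlaces c d A N)).idealOne) = 0)
    (χ : DirichletCharacter ℂ (cycLevel p (n + 1) ∅))
    (hχ : ∀ σ ∈ K.layerSubgroup n,
      χ ((modNCyclotomicCharacter ℚ (cycLevel p (n + 1) ∅) σ : (ZMod (cycLevel p (n + 1) ∅))ˣ) :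
        ZMod (cycLevel p (n + 1) ∅)) = 1)
    (hodd : χ (-1) = -1) (d' : ℤ) (hcd : Int.gcd (c * d) (cycLevel p (n + 1) ∅ * A) = 1)
    (hdd' : d * d' ≡ 1 [ZMOD (A : ℤ)]) {Lχ : ℂ → ℂ}
    (hLχ : IsDepletedTwistedL f (cycLevel p (n + 1) ∅) (p * A) χ Lχ) :
    -(κ' : ℂ) * (Lχ 1 / (Complex.I * (minusPeriod f : ℂ))) *
      cuspFactor f false (fun k ↦ χ⁻¹ (k : ZMod (cycLevel p (n + 1) ∅))) c d a A d' = 0 := by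
  have h5 := ((hbody.2.2.2.2.2) (n + 1) (cyclotomicLevelsRat p (badPlaces c d A N)).idealOne d' χ Lχ hcd
    hdd' hLχ).2 hodd
  have hcs : charSum (cycLevel p (n + 1) (cyclotomicLevelsRat p (badPlaces c d A N)).idealOne.1)
      (ι (cycLevel p (n + 1) (cyclotomicLevelsRat p (badPlaces c d A N)).idealOne.1)) χ
      (x (n + 1) (cyclotomicLevelsRat p (badPlaces c d A N)).idealOne) = 0 :=
    charSum_eq_zero_of_levelToLayer_eq_zero hbody hK hp n h0 χ hχ
  rw [hcs] at h5
  exact h5.symm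

/-- **Clean form**: for `f` the newform of `W` (`Ω⁺_f > 0`, `IsNewform0.plusPeriod_pos_holds`) and a non-zero constant
`κ`, layer-vanishing forces `Lχ(1) · R⁻_χ̄(c,d,a,A,d′) = 0` for every even character `χ` of `Gal(ℚ_n/ℚ)` mod `p^{n+1}`
and every entire continuation `Lχ` of the depleted twisted series.
[cite: Kato2004Asterisque, Thm. 9.7 (p. 189), Thm. 6.6 (1) (p. 163), Thm. 12.5 (1) (pp. 221–222)] -/
theorem zetaBody_depletedL_mul_cuspFactor_eq_zero_of_levelToLayer_eq_zero [NeZero N]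
    (hbody : ZetaBody W p f ι κ' Λ' c d a A z x) (hf : IsNewformOf W f) (hκ' : κ' ≠ 0)
    (hK : K.IsCyclotomic) (hp : p ≠ 2) (n : ℕ)
    (h0 : levelToLayer W p hK hp (badPlaces c d A N) n
      (z (n + 1) (cyclotomicLevelsRat p (badPlaces c d A N)).idealOne) = 0)
    (χ : DirichletCharacter ℂ (cycLevel p (n + 1) ∅))
    (hχ : ∀ σ ∈ K.layerSubgroup n,
      χ ((modNCyclotomicCharacter ℚ (cycLevel p (n + 1) ∅) σ : (ZMod (cycLevel p (n + 1) ∅))ˣ) :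
        ZMod (cycLevel p (n + 1) ∅)) = 1)
    (heven : χ (-1) = 1) (d' : ℤ) (hcd : Int.gcd (c * d) (cycLevel p (n + 1) ∅ * A) = 1)
    (hdd' : d * d' ≡ 1 [ZMOD (A : ℤ)]) {Lχ : ℂ → ℂ}
    (hLχ : IsDepletedTwistedL f (cycLevel p (n + 1) ∅) (p * A) χ Lχ) :
    Lχ 1 * cuspFactor f true (fun k ↦ χ⁻¹ (k : ZMod (cycLevel p (n + 1) ∅))) c d a A d' = 0 := by
  have h := zetaBody_value_even_eq_zero_of_levelToLayer_eq_zero hbody hK hp n h0 χ hχ heven d' hcd hdd' hLχ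
  have hΩ : (plusPeriod f : ℂ) ≠ 0 := by
    exact_mod_cast (IsNewform0.plusPeriod_pos_holds hf.1 hf.coeffField_eq_bot).ne'
  have hκ : (κ' : ℂ) ≠ 0 := by exact_mod_cast hκ'
  rw [mul_assoc, mul_eq_zero] at h
  rcases h with h | h
  · exact absurd h hκ
  · rw [div_mul_eq_mul_div, div_eq_zero_iff] at h
    exact h.resolve_right hΩ

end LayerValues

/-! ## §4 Admissible zeta classes: `z₀ = 0` forces every layer value of ITS Kato family to vanish -/

section Admissible

variable {W : WeierstrassCurve ℚ} [W.IsElliptic] [W.IsGloballyMinimal] {p : ℕ} [Fact p.Prime]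
  [ContinuousSMul ℤ_[p] (W.tateModule p)] {K : ZpExtension ℚ p} {hK : K.IsCyclotomic}
  {γ : absoluteGaloisGroup ℚ} {I : IwasawaH1Data W p K γ} {z₀ : I.H}

omit [Fact p.Prime] in
/-- **The guards of Kato's parameters give the value-law guard at every `p`-power level**: `(c, 6pA) = 1`,
`(d, 6pN) = 1` and `dd′ ≡ 1 (A)` imply `(cd, p^{n+1}·A) = 1` ((8.1.2): `prime(cd) ∩ prime(m·p·A) = ∅`).
[cite: Kato2004Asterisque, (8.1.2) (p. 180) and Ex. 13.3 (p. 225)] -/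
theorem gcd_mul_cycLevel_mul_eq_one_of_guards {c d d' : ℤ} {A N : ℕ} (hc : Int.gcd c (6 * p * A) = 1)
    (hd : Int.gcd d (6 * p * N) = 1) (hdd' : d * d' ≡ 1 [ZMOD (A : ℤ)]) (n : ℕ) :
    Int.gcd (c * d) (cycLevel p (n + 1) ∅ * A) = 1 := by
  rw [← Int.isCoprime_iff_gcd_eq_one] at hc hd ⊢
  have hcp : IsCoprime c (p : ℤ) := (hc.of_mul_right_left).of_mul_right_right
  have hcA : IsCoprime c (A : ℤ) := hc.of_mul_right_right
  have hdp : IsCoprime d (p : ℤ) := (hd.of_mul_right_left).of_mul_right_right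
  have hdA : IsCoprime d (A : ℤ) := by
    obtain ⟨k, hk⟩ := (Int.ModEq.dvd hdd'.symm : (A : ℤ) ∣ d * d' - 1)
    exact ⟨d', -k, by linear_combination hk⟩
  have hcd_p : IsCoprime (c * d) ((p : ℤ) ^ (n + 1)) := (hcp.mul_left hdp).pow_right
  have hcd_A : IsCoprime (c * d) (A : ℤ) := hcA.mul_left hdA
  have : IsCoprime (c * d) ((p : ℤ) ^ (n + 1) * A) := hcd_p.mul_right hcd_A
  simpa [cycLevel, Finset.prod_empty] using this

/-- **An admissible class that VANISHES has all layer values of its Kato family equal to zero.** If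
`AdmissibleZetaClassBody W p K hK I z₀` and `z₀ = 0`, then for the witnessing data — `p ≠ 2`, the newform `f` of `W`
(level `N`), GUARDED parameters `(c, d₁, a, A, d′)` (`A ≥ 1`, `(c, 6pA) = 1`, `(d₁, 6pN) = 1`, `d₁d′ ≡ 1 (A)`,
`R⁻_𝟙 = ratCuspFactor f true c d₁ a A d′ ≠ 0`) — one has, at EVERY layer `n` and for EVERY even Dirichlet character
`χ mod p^{n+1}` of `Gal(ℚ_n/ℚ)` and every entire continuation `Lχ` of the `(pA·p^{n+1})`-depleted twisted series:
`Lχ(1) · R⁻_χ̄(c, d₁, a, A, d′) = 0`. Mechanism: the position clause (A6′) gives `L • z₀ = r • y` with `L, r ≠ 0`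
(`katoMultiplier_ne_zero`), so `y = 0` in the torsion-free `𝐇¹_Γ` (`IwasawaH1Data.eq_zero_iff_of_smul_eq_smul`);
`I.proj n y = Cor(z_{n+1,∅})` ((A4)) then vanishes for all `n`, and §3 applies with the guards (A3).
[cite: Kato2004Asterisque, Thm. 12.4 (2) (p. 221), Thm. 12.5 (1) (pp. 221–222), Lemma 13.10 (1) (p. 230), Thm. 6.6 (1) (p. 163)] -/
theorem AdmissibleZetaClassBody.exists_forall_value_eq_zero_of_eq_zero [Module.Free ℤ_[p] (W.tateModule p)]
    [Module.Finite ℤ_[p] (W.tateModule p)] (h : AdmissibleZetaClassBody W p K hK I z₀)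
    (hγ : K.IsTopGenerator γ) (hz : z₀ = 0) :
    ∃ (_ : p ≠ 2) (N : ℕ) (_ : NeZero N) (f : CuspForm (Gamma0 N) 2) (_ : IsNewformOf W f)
      (c d₁ a : ℤ) (A : ℕ) (d' : ℤ),
      0 < A ∧ Int.gcd c (6 * p * A) = 1 ∧ Int.gcd d₁ (6 * p * N) = 1 ∧ d₁ * d' ≡ 1 [ZMOD (A : ℤ)] ∧
      ratCuspFactor f true c d₁ a A d' ≠ 0 ∧
      ∀ (n : ℕ) (χ : DirichletCharacter ℂ (cycLevel p (n + 1) ∅)),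
        (∀ σ ∈ K.layerSubgroup n,
          χ ((modNCyclotomicCharacter ℚ (cycLevel p (n + 1) ∅) σ : (ZMod (cycLevel p (n + 1) ∅))ˣ) :
            ZMod (cycLevel p (n + 1) ∅)) = 1) →
        χ (-1) = 1 →
        ∀ (Lχ : ℂ → ℂ), IsDepletedTwistedL f (cycLevel p (n + 1) ∅) (p * A) χ Lχ →
          Lχ 1 * cuspFactor f true (fun k ↦ χ⁻¹ (k : ZMod (cycLevel p (n + 1) ∅))) c d₁ a A d' = 0 := by
  obtain ⟨hp, N, hN, f, hf, ι, q, Λ, hq, -, c, d₁, a, A, d', hA, hc, hd, hdd', hR, z, x, hzeta, y, hy,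
    qm, perRatio, e, u, n₁, n₂, n₃, n₄, σc, σd, σℓ, hqm, -, h₁, h₂, h₃, h₄, -, -, -, -, -, -,
    hpos⟩ := h
  have hL : (p : IwasawaAlgebra p) ^ (-e).toNat *
      katoMultiplier p c d₁ n₁ n₂ n₃ n₄
        ((IwasawaCharacter.Psi p ℤ_[p] K σc : (PowerSeries ℤ_[p])ˣ) : IwasawaAlgebra p)
        ((IwasawaCharacter.Psi p ℤ_[p] K σd : (PowerSeries ℤ_[p])ˣ) : IwasawaAlgebra p)
        (A.primeFactors.erase p) (fun ℓ => W.LFunction ℓ) (fun ℓ => if ℓ ∣ N then 0 else 1)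
        (fun ℓ => ((IwasawaCharacter.Psi p ℤ_[p] K (σℓ ℓ) : (PowerSeries ℤ_[p])ˣ) : IwasawaAlgebra p)) ≠ 0 :=
    pow_mul_ne_zero_of_ne_zero p
      (katoMultiplier_ne_zero p W hf K c d₁ a A d' hqm.ne' h₁ h₂ h₃ h₄ hR σc σd σℓ) _
  have hr : (u : IwasawaAlgebra p) * (p : IwasawaAlgebra p) ^ e.toNat ≠ 0 := by
    rw [mul_comm]
    exact pow_mul_ne_zero_of_ne_zero p u.ne_zero _
  have hy0 : y = 0 := (I.eq_zero_iff_of_smul_eq_smul hγ hL hr hpos).mp hz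
  have hq' : ((q : ℚ) : ℝ) ≠ 0 := by exact_mod_cast hq
  refine ⟨hp, N, hN, f, hf, c, d₁, a, A, d', hA, hc, hd, hdd', hR, fun n χ hχ heven Lχ hLχ => ?_⟩
  have h0 : levelToLayer W p hK hp (badPlaces c d₁ A N) n
      (z (n + 1) (cyclotomicLevelsRat p (badPlaces c d₁ A N)).idealOne) = 0 := by
    rw [← hy n, hy0, map_zero]
  exact zetaBody_depletedL_mul_cuspFactor_eq_zero_of_levelToLayer_eq_zero hzeta hf hq' hK hp n h0 χ hχ heven
    d' (gcd_mul_cycLevel_mul_eq_one_of_guards hc hd hdd' n) hdd' hLχ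

/-- **Closed form** (any instances of the two `Prop`-valued structure facts, as in `isAdmissibleZetaClass_iff`):
an admissible zeta class `z₀` of `I` with `z₀ = 0` has all even layer values `Lχ(1)·R⁻_χ̄` of its Kato family equal
to zero. Contrapositively, ONE character `χ` of `Gal(ℚ_n/ℚ)` with `Lχ(1)·R⁻_χ̄ ≠ 0` (Rohrlich + non-vanishing Euler
factors + `R⁻_χ̄ ≠ 0`) proves `z₀ ≠ 0` — the input "`z ≠ 0`" of the descent datum (`KatoDescentDatum.z_ne_zero`).
[cite: Kato2004Asterisque, Thm. 12.4 (2) (p. 221), Thm. 12.5 (1) (pp. 221–222), Thm. 6.6 (1) (p. 163)] -/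
theorem IsAdmissibleZetaClass.exists_forall_value_eq_zero_of_eq_zero [Module.Free ℤ_[p] (W.tateModule p)]
    [Module.Finite ℤ_[p] (W.tateModule p)] (h : IsAdmissibleZetaClass W p K hK I z₀)
    (hγ : K.IsTopGenerator γ) (hz : z₀ = 0) :
    ∃ (_ : p ≠ 2) (N : ℕ) (_ : NeZero N) (f : CuspForm (Gamma0 N) 2) (_ : IsNewformOf W f)
      (c d₁ a : ℤ) (A : ℕ) (d' : ℤ),
      0 < A ∧ Int.gcd c (6 * p * A) = 1 ∧ Int.gcd d₁ (6 * p * N) = 1 ∧ d₁ * d' ≡ 1 [ZMOD (A : ℤ)] ∧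
      ratCuspFactor f true c d₁ a A d' ≠ 0 ∧
      ∀ (n : ℕ) (χ : DirichletCharacter ℂ (cycLevel p (n + 1) ∅)),
        (∀ σ ∈ K.layerSubgroup n,
          χ ((modNCyclotomicCharacter ℚ (cycLevel p (n + 1) ∅) σ : (ZMod (cycLevel p (n + 1) ∅))ˣ) :
            ZMod (cycLevel p (n + 1) ∅)) = 1) →
        χ (-1) = 1 →
        ∀ (Lχ : ℂ → ℂ), IsDepletedTwistedL f (cycLevel p (n + 1) ∅) (p * A) χ Lχ →
          Lχ 1 * cuspFactor f true (fun k ↦ χ⁻¹ (k : ZMod (cycLevel p (n + 1) ∅))) c d₁ a A d' = 0 :=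
  ((isAdmissibleZetaClass_iff W p K hK I z₀).mp h).exists_forall_value_eq_zero_of_eq_zero hγ hz

end Admissible

end Literature.NumberTheory.EllipticCurves.Kato2004

end
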